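import Literature.NumberTheory.Sieve.HeathBrownCubicGrossenZFR
import Literature.NumberTheory.LFunctions.LogRieszMeanConductor
import HarnessLib

/-!
# The prime number theorem for `L(s, ν^{(j,k)})` in the classical region with conductor

The analytic core of T. Mitsui's prime number theorem with Grössencharakteren (Jap. J. Math. 26
(1956), Lemma 5) = Lemma 9.4 of D. R. Heath-Brown, *Primes represented by `x³ + 2y³`*, Acta Math. 186
(2001), for `K = ℚ(∛2)`: the zero-free-region datum of `HeathBrownCubicGrossenZFR`
(`exists_twistedZFRData`), the zero-free region and the bound for `L'/L`
(`TwistedZFRData.exists_logDeriv_bound_const`), fed into the conductor-uniform Perron engine for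
logarithmic Riesz means (`LogRieszMeanConductor.norm_logRieszMean_le_of_le_sqrt`).

* `tsum_norm_term_twistVonMangoldt_le` — `∑ ‖Λ_ν(n) n^{−σ}‖ ≤ Re L(Λ_K, σ)`;
* **`exists_logRieszMean_twistVonMangoldt_bound`** — absolute `c > 0`, `C ≥ 0` such that for every
  non-trivial `ν^{(j,k)} mod q`, every `δ ∈ (0,1/18]` with `L(σ, ν) ≠ 0` for real `σ > 1 − δ`, and every
  `x ≥ e⁴` with `max(log Q, 2c/δ) ≤ √(log x)` (`Q = condQZ q j k = 16 q³(|j|+|k|+2)²`):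
  `‖∑_{n≤x} Λ_ν(n) log(x/n)‖ ≤ C (log Q + 2)³ δ⁻¹ (log x)² x exp(−(c/6)√(log x))`.
  The hypothesis on real zeros is void unless `ν` is real quadratic (`exists_zeroFree_grossenL`:
  zeros near `1` are real and `ν²` is then trivial) — the exceptional zero, to be placed by Siegel's
  theorem (`SiegelTheoremAbstract`); the choice of the region parameter `λ = max(log Q, 2c/δ)` keeps
  the contour `δ/2` away from it.

Everything is PROVED; no definitions, no named facts. Removing the logarithmic weight
(`LogRieszMeanConductor.norm_sum_le_of_logRieszMean`) and the prime-ideal powers turns this into the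
printed `∑_{N(P)≤z} ν(P) ≪ z exp(−c√(log z))` for `q ≤ (log z)^A`, `|j|, |k| ≤ exp(c√(log z))`.

## References

* T. Mitsui, *Generalized prime number theorem*, Jap. J. Math. 26 (1956), 1–42, Lemma 5. [cite: Mitsui1956, Lemma 5]
* D. R. Heath-Brown, *Primes represented by `x³ + 2y³`*, Acta Math. 186 (2001), §9 Lemma 9.4, p. 55.
  [cite: HeathBrownActa2001, §9 Lemma 9.4]
* H. L. Montgomery, R. C. Vaughan, *Multiplicative Number Theory I*, CUP 2007, §11.1 Theorem 11.3,
  §11.3 (proof of Theorem 11.16). [cite: MontgomeryVaughan2007, §11.1 Theorem 11.3]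

## Mathlib / tree search

Tree: `HeathBrownCubicGrossenZFR.exists_twistedZFRData`, `TwistedZFRData.exists_logDeriv_bound_const`,
`PerronConductor.norm_logRieszMean_le_of_le_sqrt`, `TwistedDedekindCoefficients`
(`LSeriesSummable_twistVonMangoldt`, `norm_twistVonMangoldt_le`, `LSeriesSummable_vonMangoldtNorm`),
`ClassicalZFRData.one_le_log_tau/one_lt_log_four`. Mathlib: `DifferentiableOn.deriv`, `Complex.re_tsum`,
`Real.exp_one_gt_d9`.
-/

noncomputable section

namespace Literature.NumberTheory.Sieve.CubicSieve

open NumberField Finset Complex Set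
open LFunctions LFunctions.NumberField LFunctions.PartialSumContinuation LFunctions.CubeRootTwoField CubicPrimes
open LFunctions.PerronConductor

section PNT

variable {q : ℕ}

/-- The sum of the norms of the terms of `L(Λ_ν, σ)` is at most `Re L(Λ_K, σ)` (`σ > 1`). [folklore] -/
theorem tsum_norm_term_twistVonMangoldt_le {ν : Ideal (𝓞 K) →*₀ ℂ} (hν : ∀ I, ‖ν I‖ ≤ 1) {σ : ℝ}
    (hσ : 1 < σ) :
    ∑' n, ‖LSeries.term (twistVonMangoldt K ν) σ n‖ ≤ (LSeries (fun n ↦ (vonMangoldtNorm K n : ℂ)) σ).re := by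
  set g : ℕ → ℂ := fun n ↦ (vonMangoldtNorm K n : ℂ) with hg
  have hs : 1 < (σ : ℂ).re := by simp [hσ]
  have hsumσ : LSeriesSummable g (σ : ℂ) := LSeriesSummable_vonMangoldtNorm (K := K) hs
  have h2 : ∀ n, ‖LSeries.term g (σ : ℂ) n‖ = (LSeries.term g (σ : ℂ) n).re := by
    intro n
    rcases eq_or_ne n 0 with rfl | hn
    · simp
    rw [LSeries.norm_term_eq, if_neg hn, LSeries.term_of_ne_zero hn, hg]
    simp only
    rw [Complex.norm_real, Real.norm_of_nonneg (vonMangoldtNorm_nonneg n)]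
    have : (n : ℂ) ^ (σ : ℂ) = ((n : ℝ) ^ σ : ℝ) := by
      rw [Complex.ofReal_cpow (Nat.cast_nonneg n)]; simp
    rw [this, ← Complex.ofReal_div]
    exact (Complex.ofReal_re _).symm
  have h3 : (LSeries g (σ : ℂ)).re = ∑' n, (LSeries.term g (σ : ℂ) n).re := by
    rw [LSeries, Complex.re_tsum hsumσ]
  have h4 : ∀ n, ‖LSeries.term (twistVonMangoldt K ν) σ n‖ ≤ ‖LSeries.term g (σ : ℂ) n‖ := by
    intro n
    rcases eq_or_ne n 0 with rfl | hn
    · simp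
    rw [LSeries.norm_term_eq, if_neg hn, LSeries.norm_term_eq, if_neg hn, hg]
    simp only
    rw [Complex.norm_real, Real.norm_of_nonneg (vonMangoldtNorm_nonneg n)]
    exact div_le_div_of_nonneg_right (norm_twistVonMangoldt_le hν n) (by positivity)
  have hfs : Summable fun n ↦ ‖LSeries.term (twistVonMangoldt K ν) σ n‖ :=
    Summable.of_nonneg_of_le (fun n ↦ norm_nonneg _) h4 hsumσ.norm
  calc ∑' n, ‖LSeries.term (twistVonMangoldt K ν) σ n‖
      ≤ ∑' n, ‖LSeries.term g (σ : ℂ) n‖ := Summable.tsum_le_tsum h4 hfs hsumσ.norm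
    _ = ∑' n, (LSeries.term g (σ : ℂ) n).re := tsum_congr h2
    _ = (LSeries g (σ : ℂ)).re := h3.symm

/-- **The logarithmic Riesz mean of `Λ_ν` in the classical region with conductor** (the analytic core
of Mitsui's Lemma 5 / Heath-Brown's Lemma 9.4): there are absolute `c > 0`, `C ≥ 0` such that for
every non-trivial `ν = ν^{(j,k)} mod q` (`q ≥ 1`), every `δ ∈ (0, 1/18]` such that `L(σ, ν) ≠ 0` for real
`σ > 1 − δ` (so only `σ > 17/18`, inside the half-plane of holomorphy, is tested; automatic unless `ν`
is real quadratic — the Siegel zero), and every `x ≥ e⁴` with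
`max(log Q, 2c/δ) ≤ √(log x)` (`Q = 16q³(|j|+|k|+2)²`),
`‖∑_{n ≤ x} Λ_ν(n) log(x/n)‖ ≤ C (log Q + 2)³ δ⁻¹ (log x)² · x · exp(−(c/6)√(log x))`.
[cite: Mitsui1956, Lemma 5; HeathBrownActa2001, §9 Lemma 9.4] -/
theorem exists_logRieszMean_twistVonMangoldt_bound :
    ∃ c : ℝ, 0 < c ∧ ∃ C : ℝ, 0 ≤ C ∧ ∀ (q : ℕ) (hq : 1 ≤ q) (χ : MulChar (QuotMod q) ℂ) (j k : ℤ),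
      ¬ IsTrivialMod q (grossenChar hq χ j k) → ∀ δ : ℝ, 0 < δ → δ ≤ 1 / 18 →
        (∀ β : ℝ, 1 - δ < β → grossenL hq χ j k β ≠ 0) →
        ∀ x : ℝ, Real.exp 4 ≤ x →
          max (Real.log (condQZ q j k)) (2 * c / δ) ≤ Real.sqrt (Real.log x) →
          ‖∑ n ∈ Finset.Ioc 0 ⌊x⌋₊, twistVonMangoldt K (grossenChar hq χ j k) n * (Real.log (x / n) : ℂ)‖ ≤
            C * ((Real.log (condQZ q j k) + 2) ^ 3 / δ) * Real.log x ^ 2 * x *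
              Real.exp (-(c / 6 * Real.sqrt (Real.log x))) := by
  obtain ⟨Cg, c₁, K₀, C₂, hCg, hc₁, hK₀, hC₂, hdata⟩ := exists_twistedZFRData
  obtain ⟨cZ, hcZ, CZ, hCZ, hzf, hld⟩ := TwistedZFRData.exists_logDeriv_bound_const (η := 1 / 18)
    (A := 1) (Cg := Cg) (c₁ := c₁) (K₀ := K₀) (C₂ := C₂) (by norm_num) (by norm_num) zero_le_one hK₀ hC₂
  set c : ℝ := min cZ (1 / 20) with hc
  have hc0 : 0 < c := lt_min hcZ (by norm_num)
  have hcZ' : c ≤ cZ := min_le_left _ _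
  have hc20 : c ≤ 1 / 20 := min_le_right _ _
  refine ⟨c, hc0, 1 + K₀ + 12 * CZ, by positivity, fun q hq χ j k hν δ hδ hδ1 hnz x hx hlam ↦ ?_⟩
  obtain ⟨pole, Λ₂, hpole, h⟩ := hdata q hq χ j k hν
  set ν := grossenChar hq χ j k with hνdef
  have hν1 : ∀ I, ‖ν I‖ ≤ 1 := norm_grossenChar_le hq χ j k
  set Q : ℝ := condQZ q j k with hQ
  have hQ1 : 1 ≤ Q := one_le_condQZ hq j k
  have hlogQ : 0 ≤ Real.log Q := Real.log_nonneg hQ1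
  set lam : ℝ := max (Real.log Q) (2 * c / δ) with hlamdef
  have hlam0 : 0 ≤ lam := le_max_of_le_left hlogQ
  have hlamQ : Real.log Q ≤ lam := le_max_left _ _
  have hlamδ : 2 * c / δ ≤ lam := le_max_right _ _
  have hlog4 : 1 < Real.log 4 := ClassicalZFRData.one_lt_log_four
  have hlog4' : Real.log 4 < 2 := by
    have he : (4 : ℝ) < Real.exp 2 := by
      have h1 := Real.exp_one_gt_d9
      have : Real.exp 2 = Real.exp 1 * Real.exp 1 := by rw [← Real.exp_add]; norm_num
      nlinarith
    have : Real.log 4 < Real.log (Real.exp 2) := Real.log_lt_log (by norm_num) he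
    rwa [Real.log_exp] at this
  set L := grossenL hq χ j k with hLdef
  -- points of the region: `Re s > 1 − c/(lam + log τ)` have `Re s > 17/18`, `Re s > 1 − δ/2`,
  -- and lie in the region of the datum
  have hτ : ∀ t : ℝ, 1 ≤ Real.log (|t| + 4) := ClassicalZFRData.one_le_log_tau
  have hregion : ∀ s : ℂ, 1 - c / (lam + Real.log (|s.im| + 4)) < s.re →
      17 / 18 < s.re ∧ 1 - δ / 2 < s.re ∧ 1 - cZ / (Real.log Q + Real.log (|s.im| + 4)) < s.re := by
    intro s hs
    have hℓ : 1 ≤ lam + Real.log (|s.im| + 4) := by linarith [hτ s.im]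
    have hℓ0 : 0 < lam + Real.log (|s.im| + 4) := by linarith
    refine ⟨?_, ?_, ?_⟩
    · have : c / (lam + Real.log (|s.im| + 4)) ≤ 1 / 20 := by
        rw [div_le_iff₀ hℓ0]; nlinarith
      linarith
    · have : c / (lam + Real.log (|s.im| + 4)) ≤ δ / 2 := by
        rw [div_le_iff₀ hℓ0]
        have h1 : 2 * c ≤ lam * δ := (div_le_iff₀ hδ).1 hlamδ
        nlinarith [hτ s.im]
      linarith
    · have hℓQ : 0 < Real.log Q + Real.log (|s.im| + 4) := by linarith [hτ s.im]
      have : c / (lam + Real.log (|s.im| + 4)) ≤ cZ / (Real.log Q + Real.log (|s.im| + 4)) := by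
        rw [div_le_div_iff₀ hℓ0 hℓQ]
        calc c * (Real.log Q + Real.log (|s.im| + 4)) ≤ cZ * (Real.log Q + Real.log (|s.im| + 4)) :=
              mul_le_mul_of_nonneg_right hcZ' hℓQ.le
          _ ≤ cZ * (lam + Real.log (|s.im| + 4)) := by gcongr
      linarith
  -- no zeros of `L` in the region
  have hLne : ∀ s : ℂ, 1 - c / (lam + Real.log (|s.im| + 4)) < s.re → L s ≠ 0 := by
    intro s hs hLs
    obtain ⟨h17, hδ2, hZ⟩ := hregion s hs
    have hZ' : 1 - 2 * cZ / (Real.log Q + Real.log (|s.im| + 4)) < s.re := by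
      have : 0 ≤ cZ / (Real.log Q + Real.log (|s.im| + 4)) := by
        have := hτ s.im; positivity
      have h2 : 2 * cZ / (Real.log Q + Real.log (|s.im| + 4)) = 2 * (cZ / (Real.log Q + Real.log (|s.im| + 4))) := by
        ring
      linarith
    obtain ⟨-, him⟩ := hzf pole Q _ _ _ _ h s hLs hZ'
    have hsreal : s = ((s.re : ℝ) : ℂ) := by apply Complex.ext <;> simp [him]
    exact hnz s.re (by linarith) (by rw [← hsreal]; exact hLs)
  -- holomorphy of `L` near the region
  have hdiffL : DifferentiableOn ℂ L {s : ℂ | 17 / 18 < s.re} :=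
    (differentiableOn_grossenL hq χ j k hν).mono fun s hs ↦ by
      simp only [Set.mem_setOf_eq] at hs ⊢; linarith
  have hopen : IsOpen {s : ℂ | (17 : ℝ) / 18 < s.re} := isOpen_lt continuous_const Complex.continuous_re
  set F' : ℂ → ℂ := fun s ↦ -(deriv L s / L s) with hF'
  -- the hypotheses of the Perron engine
  have hsum : ∀ σ : ℝ, 1 < σ → LSeriesSummable (twistVonMangoldt K ν) σ := fun σ hσ ↦
    LSeriesSummable_twistVonMangoldt hν1 (by simp [hσ])
  have hB : ∀ σ : ℝ, 1 < σ → σ ≤ 2 →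
      ∑' n, ‖LSeries.term (twistVonMangoldt K ν) σ n‖ ≤ (1 + K₀) / (σ - 1) := by
    intro σ hσ hσ2
    refine (tsum_norm_term_twistVonMangoldt_le hν1 hσ).trans ?_
    have h1 := h.re_LSeries₀_le σ hσ hσ2
    have hσ0 : 0 < σ - 1 := by linarith
    rw [add_div]
    have : K₀ ≤ K₀ / (σ - 1) := by
      rw [le_div_iff₀ hσ0]; nlinarith
    linarith
  have hFa : ∀ s : ℂ, 1 < s.re → F' s = LSeries (twistVonMangoldt K ν) s := by
    intro s hs
    simp only [hF']
    rw [h.logDeriv_eq s hs, neg_neg]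
  have hFd : DifferentiableOn ℂ F' {s : ℂ | 1 - c / (lam + Real.log (|s.im| + 4)) < s.re} := by
    intro s hs
    obtain ⟨h17, -, -⟩ := hregion s hs
    have hmem : s ∈ {s : ℂ | (17 : ℝ) / 18 < s.re} := h17
    have hLd : DifferentiableAt ℂ L s := (hdiffL s hmem).differentiableAt (hopen.mem_nhds hmem)
    have hL'd : DifferentiableAt ℂ (deriv L) s :=
      ((hdiffL.deriv hopen) s hmem).differentiableAt (hopen.mem_nhds hmem)
    exact ((hL'd.div hLd (hLne s hs)).neg).differentiableWithinAt
  set M : ℝ := 2 * CZ * (Real.log Q + Real.log 4) ^ 3 / δ with hM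
  have hM0 : 0 ≤ M := by
    have : 0 ≤ Real.log Q + Real.log 4 := by linarith
    positivity
  have hFb : ∀ s ∈ {s : ℂ | 1 - c / (lam + Real.log (|s.im| + 4)) < s.re}, s.re ≤ 2 →
      ‖F' s‖ ≤ M * (lam + Real.log (|s.im| + 4)) ^ (1 : ℕ) := by
    intro s hs _
    obtain ⟨h17, hδ2, hZ⟩ := hregion s hs
    have hdist : ∀ a : ℂ, L a = 0 → a.im = 0 → 1 - 2 * cZ / (Real.log Q + Real.log 4) < a.re →
        δ / 2 ≤ ‖s - a‖ := by
      intro a ha haim _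
      have hare : a.re ≤ 1 - δ := by
        by_contra hcon
        rw [not_le] at hcon
        have hareal : a = ((a.re : ℝ) : ℂ) := by apply Complex.ext <;> simp [haim]
        exact hnz a.re hcon (by rw [← hareal]; exact ha)
      calc δ / 2 ≤ s.re - a.re := by linarith
        _ = (s - a).re := by simp
        _ ≤ ‖s - a‖ := Complex.re_le_norm _
    obtain ⟨-, hb⟩ := hld pole Q _ _ _ _ h s (δ / 2) (by positivity) (by linarith) hZ.le hdist
    have hℓ : Real.log (|s.im| + 4) ≤ lam + Real.log (|s.im| + 4) := by linarith
    have hfinal : CZ * ((Real.log Q + Real.log 4) ^ 3 / (δ / 2)) * Real.log (|s.im| + 4) ≤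
        M * (lam + Real.log (|s.im| + 4)) ^ (1 : ℕ) := by
      have e : CZ * ((Real.log Q + Real.log 4) ^ 3 / (δ / 2)) = M := by rw [hM]; field_simp
      rw [e, pow_one]; exact mul_le_mul_of_nonneg_left hℓ hM0
    have : ‖F' s‖ = ‖deriv L s / L s‖ := by simp only [hF', norm_neg]
    rw [this]
    exact hb.trans hfinal
  -- the engine
  have hmain := norm_logRieszMean_le_of_le_sqrt (a := twistVonMangoldt K ν) (F := F') (p := 1)
    hlam0 hc0 (by linarith) hM0 hsum hB hFa hFd hFb hx hlam
  refine hmain.trans ?_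
  -- constants: `(1 + K₀ + 6M) ≤ (1 + K₀ + 12 CZ)(log Q + 2)³/δ`
  have hx0 : 0 < x := (Real.exp_pos 4).trans_le hx
  have hlogx : 0 ≤ Real.log x := Real.log_nonneg (by linarith [Real.add_one_le_exp (4 : ℝ)])
  have hQ2 : 1 ≤ (Real.log Q + 2) ^ 3 / δ := by
    rw [le_div_iff₀ hδ]
    have : 1 ≤ Real.log Q + 2 := by linarith
    nlinarith [one_le_pow₀ (n := 3) this]
  have hMle : M ≤ 2 * CZ * ((Real.log Q + 2) ^ 3 / δ) := by
    rw [hM, mul_div_assoc]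
    gcongr
  have hcoef : (1 + K₀) + 2 * 3 ^ (1 : ℕ) * M ≤ (1 + K₀ + 12 * CZ) * ((Real.log Q + 2) ^ 3 / δ) := by
    rw [pow_one]
    nlinarith [mul_nonneg (by positivity : (0 : ℝ) ≤ 1 + K₀) (sub_nonneg.2 hQ2)]
  have hrest : 0 ≤ Real.log x ^ (1 + 1) * x * Real.exp (-(c / 6 * Real.sqrt (Real.log x))) := by positivity
  calc ((1 + K₀) + 2 * 3 ^ (1 : ℕ) * M) * Real.log x ^ (1 + 1) * x * Real.exp (-(c / 6 * Real.sqrt (Real.log x)))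
      = ((1 + K₀) + 2 * 3 ^ (1 : ℕ) * M) * (Real.log x ^ (1 + 1) * x * Real.exp (-(c / 6 * Real.sqrt (Real.log x)))) := by
        ring
    _ ≤ ((1 + K₀ + 12 * CZ) * ((Real.log Q + 2) ^ 3 / δ)) *
        (Real.log x ^ (1 + 1) * x * Real.exp (-(c / 6 * Real.sqrt (Real.log x)))) :=
        mul_le_mul_of_nonneg_right hcoef hrest
    _ = _ := by ring

end PNT

end Literature.NumberTheory.Sieve.CubicSieve
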